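import Summits.PneNP.PneNP.Theorems.MonotoneSuffices.Negative.BlockParityDetector

/-!
# The noise law, the planted law, and the blindness of monotone functions (finite form)

`noiseLaw a β` = law of `enc u` and `plantedLaw a β` = law of `plantAll s (enc u)` for `(u, s)` uniform on
`Ω a β = (Fin a → β → Bool) × (Fin a → β)` (noise seed and planted positions INDEPENDENT and uniform), as
`PMF`s on `Coord a β → Bool` pushed forward from `PMF.uniformOfFintype (Ω a β)`.

* `plantedLaw_le_noiseLaw_add` — for every MONOTONE `f`:
  `Pr_planted[f = 1] ≤ Pr_noise[f = 1] + 4^a (⌊√N⌋ + 1) / |β|`, `N = a(|β|+1)` (from `card_bad_bound`: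
  `|β| · #bad ≤ 4^a (⌊√N⌋+1) · #Ω`, i.e. `card_bad_mul_le` and `bdry_sq_le` with `2^N = 2^a (2^|β|)^a`);
  hence `one_le_errSum_add`: type I + type II of a monotone test is `≥ 1 - 4^a (⌊√N⌋ + 1) / |β|`.
* `noiseLaw_detect` (type I of the parity test is `0`) and `plantedLaw_detect_false` (its type II is
  exactly `(2^a)⁻¹`).

Part of the negative-side lemma `monotoneSuffices_false_without_productNoise` for the crux
`Summit.PneNP.PneNP.Theses.KarlinRubin.MonotoneSuffices` (stmt-PneNP-18026, route PneNP/KarlinRubin):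
the OR-channel (stochastic-order) generalisation of the crux is false — see
`Summits/PneNP/PneNP/Theorems/MonotoneSuffices/Negative/ORChannel.lean` for the statement, the witness
and the discussion. Everything here is proved (no named facts). Refuter seat
refuter-cdisprove-stmt-PneNP-18026-0 (cdisprove, cycle 1), 2026-08-17.
-/

set_option linter.dupNamespace false -- `Summit.PneNP.PneNP.…`: summit = sub-problem name (D-0017 single-conjunct layout)

namespace Summit.PneNP.PneNP.Theorems.MonotoneSuffices.Negative

open Finset Function

section Measures

open scoped ENNReal

variable (a : ℕ) (β : Type*) [Fintype β] [DecidableEq β] [Nonempty β]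

/-- **Block-parity noise**: `a` blocks of `|β|` uniform bits, each followed by its parity bit;
the law of `enc u`, `u` uniform (pushed forward from the product sample space `Ω`). [folklore] -/
noncomputable def noiseLaw : PMF (Coord a β → Bool) :=
  (PMF.uniformOfFintype (Ω a β)).map fun p => enc p.1

/-- **The planted law**: the noise with one extra `1` OR-ed in at a uniformly random free position
of every block (independently of the noise). [folklore] -/
noncomputable def plantedLaw : PMF (Coord a β → Bool) :=
  (PMF.uniformOfFintype (Ω a β)).map fun p => plantAll p.2 (enc p.1)

variable {a β}

/-- Pushforward of a uniform law = counting. [folklore] -/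
theorem uniform_map_toOuterMeasure_setOf {Ω' γ : Type*} [Fintype Ω'] [Nonempty Ω'] (g : Ω' → γ)
    (P : γ → Prop) [DecidablePred P] :
    ((PMF.uniformOfFintype Ω').map g).toOuterMeasure {x | P x} =
      ((univ.filter fun ω => P (g ω)).card : ℝ≥0∞) / Fintype.card Ω' := by
  classical
  rw [PMF.toOuterMeasure_map_apply,
    show PMF.uniformOfFintype Ω' = PMF.uniformOfFinset univ univ_nonempty from rfl,
    PMF.toOuterMeasure_uniformOfFinset_apply, card_univ]
  congr 2
  simp only [Set.mem_preimage, Set.mem_setOf_eq]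

omit [Nonempty β] in
/-- The accepted sets of a monotone test under planting split as "already accepted" ⊔ "BAD". [folklore] -/
theorem card_filter_plantAll_eq (f : (Coord a β → Bool) → Bool) (hf : Monotone f) :
    (univ.filter fun p : Ω a β => f (plantAll p.2 (enc p.1)) = true).card =
      (univ.filter fun p : Ω a β => f (enc p.1) = true).card +
        (bad (univ.filter fun x => f x = true)).card := by
  have hunion : (univ.filter fun p : Ω a β => f (plantAll p.2 (enc p.1)) = true) =
      (univ.filter fun p : Ω a β => f (enc p.1) = true) ∪ bad (univ.filter fun x => f x = true) := by
    ext p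
    simp only [bad, mem_filter, mem_univ, true_and, mem_union, plantUpTo_eq_plantAll]
    constructor
    · intro h
      by_cases h0 : f (enc p.1) = true
      · exact Or.inl h0
      · exact Or.inr ⟨h0, h⟩
    · rintro (h | ⟨-, h⟩)
      · have hle : f (enc p.1) ≤ f (plantAll p.2 (enc p.1)) := by
          rw [← plantUpTo_eq_plantAll]; exact hf (le_plantUpTo a p.2 (enc p.1))
        rw [h] at hle
        exact top_le_iff.1 hle
      · exact h
  have hdisj : Disjoint (univ.filter fun p : Ω a β => f (enc p.1) = true)
      (bad (univ.filter fun x => f x = true)) := by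
    rw [Finset.disjoint_left]
    intro p hp hp'
    simp only [bad, mem_filter, mem_univ, true_and] at hp hp'
    exact hp'.1 hp
  rw [hunion, card_union_of_disjoint hdisj]

omit [Nonempty β] in
/-- **The finite blindness inequality (counting form).** For every monotone `f`,
`|β| · #BAD ≤ 4^a (⌊√N⌋ + 1) · #Ω` with `N = a(|β|+1)` the number of coordinates. [folklore] -/
theorem card_bad_bound (f : (Coord a β → Bool) → Bool) (hf : Monotone f) :
    Fintype.card β * (bad (univ.filter fun x => f x = true)).card ≤
      4 ^ a * (Nat.sqrt (Fintype.card (Coord a β)) + 1) * Fintype.card (Ω a β) := by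
  set F : Finset (Coord a β → Bool) := univ.filter fun x => f x = true with hFdef
  set N := Fintype.card (Coord a β) with hN
  have hF : IsUpperSet (F : Set (Coord a β → Bool)) := by
    intro x y hxy hx
    simp only [hFdef, coe_filter, Set.mem_setOf_eq, mem_univ, true_and] at hx ⊢
    have := hf hxy
    rw [hx] at this
    exact top_le_iff.1 this
  have h1 := card_bad_mul_le F
  have h2 : bdry F < (Nat.sqrt N + 1) * 2 ^ N := by
    have hsq : bdry F ^ 2 < ((Nat.sqrt N + 1) * 2 ^ N) ^ 2 := by
      calc bdry F ^ 2 ≤ N * 4 ^ N := bdry_sq_le F hF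
        _ < (Nat.sqrt N + 1) ^ 2 * 4 ^ N :=
            Nat.mul_lt_mul_of_pos_right (Nat.lt_succ_sqrt' N) (by positivity)
        _ = ((Nat.sqrt N + 1) * 2 ^ N) ^ 2 := by
            rw [mul_pow, ← pow_mul, show (4 : ℕ) = 2 ^ 2 by norm_num, ← pow_mul, mul_comm N 2]
    exact (Nat.pow_lt_pow_iff_left (by norm_num)).1 hsq
  have h3 : 2 ^ N = 2 ^ a * (2 ^ Fintype.card β) ^ a := by
    rw [hN, card_Coord, ← pow_mul, ← pow_add]
    congr 1
    ring
  calc Fintype.card β * (bad F).card ≤ 2 ^ a * Fintype.card β ^ a * bdry F := h1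
    _ ≤ 2 ^ a * Fintype.card β ^ a * ((Nat.sqrt N + 1) * 2 ^ N) := Nat.mul_le_mul_left _ h2.le
    _ = 4 ^ a * (Nat.sqrt N + 1) * Fintype.card (Ω a β) := by
        rw [card_Ω, h3, show (4 : ℕ) = 2 * 2 by norm_num, mul_pow]
        ring

/-- **Monotone FUNCTIONS are blind to the planting (finite form).** For every monotone Boolean
function `f` of the coordinates, `Pr_planted[f = 1] ≤ Pr_noise[f = 1] + 4^a (⌊√N⌋ + 1) / |β|`. [folklore] -/
theorem plantedLaw_le_noiseLaw_add (f : (Coord a β → Bool) → Bool) (hf : Monotone f) :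
    (plantedLaw a β).toOuterMeasure {x | f x = true} ≤
      (noiseLaw a β).toOuterMeasure {x | f x = true} +
        ((4 ^ a * (Nat.sqrt (Fintype.card (Coord a β)) + 1) : ℕ) : ℝ≥0∞) / Fintype.card β := by
  rw [plantedLaw, noiseLaw, uniform_map_toOuterMeasure_setOf, uniform_map_toOuterMeasure_setOf,
    card_filter_plantAll_eq f hf, Nat.cast_add, ENNReal.add_div]
  refine add_le_add le_rfl ?_
  have hb0 : (Fintype.card β : ℝ≥0∞) ≠ 0 := by exact_mod_cast Fintype.card_ne_zero
  have hΩ0 : (Fintype.card (Ω a β) : ℝ≥0∞) ≠ 0 := by exact_mod_cast Fintype.card_ne_zero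
  have hΩt : (Fintype.card (Ω a β) : ℝ≥0∞) ≠ ∞ := ENNReal.natCast_ne_top _
  have hnat := card_bad_bound f hf
  rw [ENNReal.le_div_iff_mul_le (Or.inl hb0) (Or.inl (ENNReal.natCast_ne_top _)), mul_comm,
    ← mul_div_assoc, ENNReal.div_le_iff hΩ0 hΩt]
  exact_mod_cast hnat

/-- Consequence: every monotone test has error sum at least `1 - 4^a (⌊√N⌋ + 1) / |β|`
(stated additively). [folklore] -/
theorem one_le_errSum_add (f : (Coord a β → Bool) → Bool) (hf : Monotone f) :
    1 ≤ (noiseLaw a β).toOuterMeasure {x | f x = true} +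
        (plantedLaw a β).toOuterMeasure {x | f x = false} +
        ((4 ^ a * (Nat.sqrt (Fintype.card (Coord a β)) + 1) : ℕ) : ℝ≥0∞) / Fintype.card β := by
  have hcompl : {x : Coord a β → Bool | f x = false} = {x | f x = true}ᶜ := by
    ext x; simp
  have hsum : (plantedLaw a β).toOuterMeasure {x | f x = true} +
      (plantedLaw a β).toOuterMeasure {x | f x = false} = 1 := by
    rw [hcompl]
    -- complement rule for a PMF
    rw [PMF.toOuterMeasure_apply, PMF.toOuterMeasure_apply, ← ENNReal.tsum_add, ← (plantedLaw a β).tsum_coe]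
    congr 1
    funext x
    by_cases hx : x ∈ {x : Coord a β → Bool | f x = true}
    · rw [Set.indicator_of_mem hx, Set.indicator_of_notMem (show x ∉ {x | f x = true}ᶜ from fun h => h hx),
        add_zero]
    · rw [Set.indicator_of_notMem hx, Set.indicator_of_mem (show x ∈ {x | f x = true}ᶜ from hx), zero_add]
  calc (1 : ℝ≥0∞) = (plantedLaw a β).toOuterMeasure {x | f x = true} +
        (plantedLaw a β).toOuterMeasure {x | f x = false} := hsum.symm
    _ ≤ ((noiseLaw a β).toOuterMeasure {x | f x = true} +
          ((4 ^ a * (Nat.sqrt (Fintype.card (Coord a β)) + 1) : ℕ) : ℝ≥0∞) / Fintype.card β) +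
        (plantedLaw a β).toOuterMeasure {x | f x = false} :=
          add_le_add (plantedLaw_le_noiseLaw_add f hf) le_rfl
    _ = _ := by ring

/-- **The general test is exact on the noise** (type I error `0`). [folklore] -/
theorem noiseLaw_detect : (noiseLaw a β).toOuterMeasure {x | detect x = true} = 0 := by
  rw [noiseLaw, uniform_map_toOuterMeasure_setOf]
  simp [detect_enc]

/-- **The general test misses the planting with probability exactly `2^{-a}`.** [folklore] -/
theorem plantedLaw_detect_false :
    (plantedLaw a β).toOuterMeasure {x | detect x = false} = ((2 : ℝ≥0∞) ^ a)⁻¹ := by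
  rw [plantedLaw, uniform_map_toOuterMeasure_setOf]
  simp only [detect_plantAll_eq_false_iff]
  have hK := two_pow_mul_card_allTrue (a := a) (β := β)
  rw [Fintype.card_subtype] at hK
  set K := (univ.filter fun p : Ω a β => ∀ j, p.1 j (p.2 j) = true).card with hKdef
  rw [← hK]
  have hK0 : (K : ℝ≥0∞) ≠ 0 := by
    have : 0 < K := by
      rw [hKdef]
      exact Finset.card_pos.2 ⟨(fun _ _ => true, fun _ => Classical.arbitrary β), by simp⟩
    exact_mod_cast this.ne'
  have hKt : (K : ℝ≥0∞) ≠ ∞ := ENNReal.natCast_ne_top _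
  push_cast
  rw [ENNReal.div_eq_inv_mul, ENNReal.mul_inv (Or.inr hKt) (Or.inr hK0), mul_assoc,
    ENNReal.inv_mul_cancel hK0 hKt, mul_one]

end Measures

end Summit.PneNP.PneNP.Theorems.MonotoneSuffices.Negative
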